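import Summits.Ventures.PercRepro.RankDistDirectSumSC

/-!
# PercRepro — (SC) WITH TOP IS CLOSED UNDER DIRECT SUMS: the direct sum of two cells satisfying
`ShadowCumulativeTop` satisfies `ShadowCumulativeTop` (p9, gen 22)

`RankDistDirectSumSC` gives the interior levels `q < u < p` of the sum. At the top level `u = p`, the convolution
`s_p(M ⊕ N) = Σ_v s_v(M) s_{p−v}(N)` contains the term `v = p₁`, `s_{p₁}(M) s_{p₂}(N) ≥ s_{q₁}(M) s_{q₂}(N) =
s_q(M ⊕ N)` by TOP of the factors, and `C(n, p) = C(n, q)`; the level `u = q` is trivial. Hence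
**`ShadowCumulativeTop` is closed under direct sums** (`shadowCumulativeTop_disjointSum`), and the closure can be
iterated: every finite direct sum of cells satisfying (SC) with TOP satisfies (SC) with TOP, hence C-025. Nothing
here moves any window of the crux.
-/

namespace PercRepro.RankDist

open Set Finset _root_.Matroid PercRepro.ThmH

variable {α : Type} [DecidableEq α]

/-- **TOP is closed under direct sums**: `s_{q₁}(M) s_{q₂}(N) ≤ s_{p₁}(M) s_{p₂}(N) ≤ s_{p₁+p₂}(M ⊕ N)`. -/
lemma card_shadowLev_disjointSum_bot_le_top (M N : Matroid α) [M.Finite] [N.Finite] (h : Disjoint M.E N.E)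
    [hS : (M.disjointSum N h).Finite] {p₁ q₁ p₂ q₂ : ℕ} (hn₁ : (gr M).card = p₁ + q₁)
    (hr₁ : M.eRank = (p₁ : ℕ∞)) (hn₂ : (gr N).card = p₂ + q₂) (hr₂ : N.eRank = (p₂ : ℕ∞))
    (hq₁ : q₁ ≤ p₁) (hq₂ : q₂ ≤ p₂) (hM : ShadowCumulativeTop M p₁ q₁) (hN : ShadowCumulativeTop N p₂ q₂) :
    (shadowLev (M.disjointSum N h) (q₁ + q₂) (PerFlat.Uq (M.disjointSum N h) (p₁ + p₂) (q₁ + q₂))).card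
      ≤ (shadowLev (M.disjointSum N h) (p₁ + p₂) (PerFlat.Uq (M.disjointSum N h) (p₁ + p₂) (q₁ + q₂))).card := by
  rw [card_shadowLev_disjointSum_bot M N h hn₁ hr₁ hn₂ hr₂, card_shadowLev_disjointSum M N h hn₁ hr₁ hn₂ hr₂]
  -- TOP of the factors: `s_{q_i} ≤ s_{p_i}` (the `C(n_i, p_i) = C(n_i, q_i)` cancel)
  have hMtop : (shadowLev M q₁ (PerFlat.Uq M p₁ q₁)).card ≤ (shadowLev M p₁ (PerFlat.Uq M p₁ q₁)).card := by
    have h := hM p₁ hq₁ le_rfl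
    rw [Nat.choose_symm_add] at h
    exact Nat.le_of_mul_le_mul_right h (Nat.choose_pos (by omega))
  have hNtop : (shadowLev N q₂ (PerFlat.Uq N p₂ q₂)).card ≤ (shadowLev N p₂ (PerFlat.Uq N p₂ q₂)).card := by
    have h := hN p₂ hq₂ le_rfl
    rw [Nat.choose_symm_add] at h
    exact Nat.le_of_mul_le_mul_right h (Nat.choose_pos (by omega))
  calc (shadowLev M q₁ (PerFlat.Uq M p₁ q₁)).card * (shadowLev N q₂ (PerFlat.Uq N p₂ q₂)).card
      ≤ (shadowLev M p₁ (PerFlat.Uq M p₁ q₁)).card * (shadowLev N (p₁ + p₂ - p₁) (PerFlat.Uq N p₂ q₂)).card := by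
        rw [Nat.add_sub_cancel_left]
        exact Nat.mul_le_mul hMtop hNtop
    _ ≤ ∑ v ∈ Finset.range (p₁ + p₂ + 1),
          (shadowLev M v (PerFlat.Uq M p₁ q₁)).card * (shadowLev N (p₁ + p₂ - v) (PerFlat.Uq N p₂ q₂)).card :=
        Finset.single_le_sum (f := fun v => (shadowLev M v (PerFlat.Uq M p₁ q₁)).card
          * (shadowLev N (p₁ + p₂ - v) (PerFlat.Uq N p₂ q₂)).card) (fun _ _ => Nat.zero_le _)
          (Finset.mem_range.2 (by omega))

/-- **(SC) WITH TOP IS CLOSED UNDER DIRECT SUMS**: `ShadowCumulativeTop M p₁ q₁` and `ShadowCumulativeTop N p₂ q₂`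
(tight layers, `q_i ≤ p_i`) give `ShadowCumulativeTop (M ⊕ N) (p₁ + p₂) (q₁ + q₂)`. -/
theorem shadowCumulativeTop_disjointSum (M N : Matroid α) [M.Finite] [N.Finite] (h : Disjoint M.E N.E)
    [hS : (M.disjointSum N h).Finite] {p₁ q₁ p₂ q₂ : ℕ} (hn₁ : (gr M).card = p₁ + q₁)
    (hr₁ : M.eRank = (p₁ : ℕ∞)) (hn₂ : (gr N).card = p₂ + q₂) (hr₂ : N.eRank = (p₂ : ℕ∞))
    (hq₁ : q₁ ≤ p₁) (hq₂ : q₂ ≤ p₂) (hM : ShadowCumulativeTop M p₁ q₁) (hN : ShadowCumulativeTop N p₂ q₂) :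
    ShadowCumulativeTop (M.disjointSum N h) (p₁ + p₂) (q₁ + q₂) := by
  intro v hqv hvp
  rcases Nat.eq_or_lt_of_le hqv with heq | hqlt
  · rw [← heq]
  rcases Nat.eq_or_lt_of_le hvp with heq | hlt
  · rw [heq, Nat.choose_symm_add]
    exact Nat.mul_le_mul_right _ (card_shadowLev_disjointSum_bot_le_top M N h hn₁ hr₁ hn₂ hr₂ hq₁ hq₂ hM hN)
  · exact shadowCumulative_disjointSum M N h hn₁ hr₁ hn₂ hr₂ hq₁ hq₂ hM hN v hqlt hlt

end PercRepro.RankDist
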